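import Summits.AtomisticToContinuum.Crystallization.Theorems.FrustratedLawDichotomyTwoShellRigidityCut
import Summits.AtomisticToContinuum.Crystallization.Theorems.FrustratedLawDichotomyTwoShellRigidityDoorTol

/-!
# FrustratedLawDichotomy · beneath the cut `KR2_shape ⟸ G ∧ P ∧ M` (p820342) — THE CELLS OF M, M⁺, and the θ-DIAL
# (decomp-a2c, lens-5 «finite/base range + asymptotic regime + bridge», gen 30; critic rows 419, 426 (iii), 428 (5); census KR18 / BASIN)

This file continues the landed cut `FrustratedLawDichotomyTwoShellRigidityCut` (lens-5 g29; `G = LinkClassification`, `P = CapForcing`,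
`M = CappedRigidity`, `kr2Shape_of_cut : G (1/100) → P (1/100) → M (1/100) (1/20) → KR2Shape`).  It adds no hypothesis to that column; it
types the lens-5 pieces BENEATH `M`, proves their glue, makes the column θ-parametric through the tolerance door (p818040), and types the
shared two-shell statement `M⁺` of critic row 428 (5).

## gen 30 (lens-5: the same lens applied to M and to the tolerance dial θ; census KR18 / BASIN, critic row 419)

Beneath **M** one more cut, and the column made θ-parametric:

* **R = `CoarseCappedRigidity K θ`** (the BASE RANGE): link isomorphism + caps ⟹ a COARSE fit `≤ K·θ·nn_i` for one explicit constant
  `K` — linear in the bond tolerance, no goodness radius.  ATTACKABLE by hand for every `θ ≤ 1/100` through the CELL LEMMAS typed below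
  (`TetraCellAt`: centre + link triangle = near-regular tetrahedron; `OctaCellAt`: centre + link square + its cap = near-regular OCTAHEDRON —
  the `K₂,₂,₂` framework with twelve near-unit bars and three antipodal non-bonds is near-regular, which is exactly what the caps buy: the
  jitterbug twist folds the cap-free squares; `FrameAssemblyAt`: sequential placement with explicit levers).  `UniformCoarseCappedRigidity K`
  is R for all `0 < θ ≤ 1/100` at once.
* **L = `BasinCertificate K θ η`** (the TIGHT regime): inside the basin of radius `K·θ·nn_i` the fit is in fact `< η`.  INSTRUMENTABLE (census
  KR18: nd-coupled window sup `≈ 3.95·θ`, `0.0395 / 0.0397 < 1/20` at `θ = 1/100`, margin `1.27×`; the literal `θ = 1/100` is DECIDED (critic row 426 (iii)(c) R2); census TAG 157 KR2-LIT tests the literal set; kernel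
  replay = structured left inverse of the `60 × 54` capped rigidity matrix, `σ_min = 0.744`, + remainder on the basin) and PROVED VACUOUS below
  the crossover: `basinCertificate_of_lt : K·θ < η → BasinCertificate K θ η`.
* the BRIDGE is radius bookkeeping (`cappedRigidity_of_coarse_of_basin`, chaining) and the **θ-DIAL**: the tree door
  `FrustratedLawDichotomyTwoShellRigidityDoorTol` (p818040) takes ANY `0 < θ ≤ 1/100`, so for `θ < 1/(20·K)` the geometric side of the
  dichotomy column is `G θ ∧ P θ ∧ R` with NO certificate (`aperiodicFrustratedLawGap_of_price_of_coarse`), the residual moving wholly to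
  `PriceTol θ` (harder as `θ ↓`: more charged sites to price, `κ(θ) ≲ θ²`).  The column of record stays `θ = 1/100` (largest admissible `θ`,
  weakest `Price`); the dial names the certificate-free fallback literal `θ× = 1/(20·K)` once `K` is proved — lens-5 g30 MEASURED (`g30/scripts/cells.py`,
  NODE-g30.md §3): first-order cell constants `c_T = 2.09`, `c_O = 3.64` (cap `5.66`); sequential-placement assembly `K_hand ≈ 52` (fcc) /
  `≈ 82` (hcp) ⇒ `θ× ≈ 1/1030` / `1/1630` (true law `K = 3.95` would give `θ× = 1/79 > 1/100`: the gap `52 : 3.95` is the price of hand vs certificate).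
* PRIOR ART / what is new (lens-5 g30 presearch, labelled): the cell mechanism is Flatley–Theil, *Face-Centered Cubic Crystallization of
  Atomistic Configurations* (ARMA 2015) [corpus:paper:arxiv-1407.0692 p.12 Lemma 4.3: per-UNIT (tetrahedron / octahedron) rigidity
  `min_R ‖∇u − R‖² ≤ C·W_τ(u)` with NON-explicit `C, c` and an a-priori hypothesis `dist(∇u, SO(3)) ≤ c` (their remark: exchanging two opposing
  vertices gives `W_τ = 0`, so the hypothesis cannot be dropped); p.12 Thm 4.1 = Friesecke–James–Müller gluing; p.11 Prop 3.12 compatibility of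
  neighbouring cuboctahedral charts `|T − R⁻¹R'| ≤ 6ε(α)`; p.10 Thm 3.5 = 24 contacts ⇒ cuboctahedron or twisted cuboctahedron] and Fuller's
  octet truss [corpus:book:edmondson1986-fuller-explanation-synergetic-geometry-r-buckminster-fuller pp 113–121]; galaxy needles "octet truss",
  "jitterbug transformation" return only descriptive books [galaxy:panama:1047972020233 Synergetics II; galaxy:panama:519699632750628 Kappraff].
  DELTA: explicit constants at a FINITE tolerance window (`θ ≤ 1/100`), the far branches excluded by TYPED clauses (antipodal non-bonds + the
  cap for the octahedral cell, all non-contacts `≥ d` for the assembly — the hexagon-fold example shows the latter is necessary) instead of an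
  a-priori nearness to `SO(3)`, sup-norm on a one-link frame instead of `L²` on a mesh, kernel-checked glue, and the crossover statement
  `K·θ < η`.  Self-assessed grade: VARIANT of a known mechanism (the value is the typed split with proved glue and the measured dial, not novelty).

-/

noncomputable section

namespace Summit.AtomisticToContinuum.Crystallization.Theorems.FrustratedLawDichotomyTwoShellRigidityCells

open Literature.Geometry.DiscreteGeometry
open Summit.AtomisticToContinuum.Crystallization.Theses.PricedLinkCensus (ChargedEnergyGap)
open Summit.AtomisticToContinuum.Crystallization.Theorems.FrustratedLawDichotomyTwoShellRigidityDoor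
  (aperiodicFrustratedLawGap_of_chargedEnergyGap_of_kr2Shape noFrustratedPeriodicMinimiser_of_chargedEnergyGap_of_kr2Shape)
open Literature.MathematicalPhysics.StatisticalMechanics (interactionEnergy lennardJones)
open Summit.AtomisticToContinuum.Crystallization.Theorems.ChargedEnergyGapNegative (eStar charged)
open Summit.AtomisticToContinuum.Crystallization.Theorems.FrustratedLawDichotomyTwoShellRigidityDoorTol
  (frustrationDensityGap_of_price_of_kr2 aperiodicFrustratedLawGap_of_price_of_kr2 noFrustratedPeriodicMinimiser_of_price_of_kr2)
open Summit.AtomisticToContinuum.Crystallization.Theorems.FrustratedLawDichotomyTwoShellRigidityCut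
/-! ## gen 30 — beneath M: `CappedRigidity θ η ⟸ CoarseCappedRigidity K θ (R) ∧ BasinCertificate K θ η (L)`; the cell lemmas of R;
the θ-parametric cut through the tolerance door (p818040) and the θ-DIAL. -/

/-- **R at one pattern — COARSE capped rigidity with constant `K` at bond tolerance `θ`**: link isomorphism + caps ⟹ the bonded dozen lies
within `K·θ·nn_i` of `nn_i·A(Pat)` for some linear isometry `A`.  Linear in `θ`, no goodness radius. -/
def CoarseCappedRigidityAt (K θ : ℝ) (Pat : Finset E3) : Prop :=
  ∀ (N : ℕ) (y : Fin N → E3) (i : Fin N) (τ : ↥Pat → Fin N), Function.Injective y →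
    (∀ a b : Fin N, a ≠ b → (7 : ℝ) / 10 ≤ dist (y a) (y b)) → LinkIso θ Pat y i τ → Capped θ Pat y i τ →
      ∃ A : E3 →ₗᵢ[ℝ] E3, ∀ u : ↥Pat, ‖(y (τ u) - y i) - nearestDist y i • A (u : E3)‖ ≤ K * θ * nearestDist y i

/-- **R = `CoarseCappedRigidity K θ` — the BASE RANGE** [WEAKER than `CappedRigidity θ η` whenever `η ≤ K·θ` (at the literals: `K ≥ 5`) ·
ATTACKABLE by hand for every `0 < θ ≤ 1/100` via `TetraCell ∧ OctaCell ∧ FrameAssembly` below + the bond-graph extraction of the cell windows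
(`d = nn_i`; radial `[d, (1+θ)d]`, link / cap bonds `[d/(1+θ), (1+θ)²d]`, non-bonds `> d`, centre–cap `> d/(1+θ)`; `τ` injective because the
pattern contact graphs are twin-free)].  Why it might fail: only through the constant — the TRUE law is `sup dev ≈ 3.95·θ` (census KR18, window
model, both patterns); a hand proof gives a larger `K` — lens-5 g30 MEASURED (`g30/scripts/cells.py`, NODE-g30.md §3): first-order cell constants
`c_T = 2.09`, `c_O = 3.64`; sequential placement `K_hand ≈ 52` (fcc: worst vertex `7.1·ε_T + 10.1·ε_O`) / `≈ 82` (hcp: `13.9·ε_T + 14.4·ε_O`),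
crossover `θ× = 1/(20·K) ≈ 1/1030` / `1/1630`.
Sources: lens-5 g30 NODE §2–3 (`g30/scripts/cells.py`); census KR18 (STATUS l.1980), BASIN (l.2005); Connelly–Guest, *Frameworks, Tensegrities
and Symmetry* (CUP 2022) ch. 3, 7 (first-order rigidity, octahedron); Kusner–Kusner–Lagarias–Shlosman arXiv:1611.10297 §5 (jitterbug);
Flatley–Theil arXiv:1407.0692 (ARMA 2015) Lemma 4.3 (unit rigidity, non-explicit constant, a-priori near-`SO(3)`), Prop 3.12, Thm 4.1. -/
def CoarseCappedRigidity (K θ : ℝ) : Prop :=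
  CoarseCappedRigidityAt K θ fccKissingPattern ∧ CoarseCappedRigidityAt K θ hcpKissingPattern

/-- **R uniformly on the dial**: `CoarseCappedRigidity K θ` for every `0 < θ ≤ 1/100` with ONE constant `K`. -/
def UniformCoarseCappedRigidity (K : ℝ) : Prop :=
  ∀ θ : ℝ, 0 < θ → θ ≤ 1 / 100 → CoarseCappedRigidity K θ

/-- **L at one pattern — the BASIN CERTIFICATE**: a capped, link-isomorphic dozen that is ALREADY within `K·θ·nn_i` of `nn_i·A₀(Pat)` for some
linear isometry `A₀` fits within `η'·nn_i` for some `η' < η` (possibly for another isometry). -/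
def BasinCertificateAt (K θ η : ℝ) (Pat : Finset E3) : Prop :=
  ∀ (N : ℕ) (y : Fin N → E3) (i : Fin N) (τ : ↥Pat → Fin N), Function.Injective y →
    (∀ a b : Fin N, a ≠ b → (7 : ℝ) / 10 ≤ dist (y a) (y b)) → LinkIso θ Pat y i τ → Capped θ Pat y i τ →
      (∃ A₀ : E3 →ₗᵢ[ℝ] E3, ∀ u : ↥Pat, ‖(y (τ u) - y i) - nearestDist y i • A₀ (u : E3)‖ ≤ K * θ * nearestDist y i) →
        ∃ (η' : ℝ) (A : E3 →ₗᵢ[ℝ] E3), η' < η ∧ ∀ u : ↥Pat, ‖(y (τ u) - y i) - nearestDist y i • A (u : E3)‖ ≤ η' * nearestDist y i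

/-- **L = `BasinCertificate K θ η` — the TIGHT / ASYMPTOTIC REGIME** [WEAKER than `CappedRigidity θ η` (one more hypothesis) · INSTRUMENTABLE
(kernel-replayed ℚ-certificate: structured per-atom left inverse of the capped rigidity matrix, `σ_min = 0.744 / 0.745`, on the basin of radius
`K·θ`; the literal `θ = 1/100` is decided (critic row 426 (iii)(c)); there the nd-coupled window sup is `0.0395 / 0.0397` against `1/20`, margin `1.27×`; census TAG 157 KR2-LIT re-measures on the literal constraint set) ·
VACUOUS when `K·θ < η` (`basinCertificate_of_lt`)].  Why it might fail: at `θ = 1/100` only if the true sup over the LITERAL constraint set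
(intruder semantics: `nn` of a named site may be attained by an unnamed one, which relaxes the non-bond clauses to `> nn_i`; bars-only sup
`0.046 / 0.047`) reaches `1/20` — then the dial moves the literal down.  Sources: census KR18 / BASIN (STATUS l.1980, l.2005); lens-5 g29
`scripts/m_box`; Tupper / interval-Krawczyk certification as in Hales–Ferguson (Kepler, DCG 36 (2006)) §7 for the replay format. -/
def BasinCertificate (K θ η : ℝ) : Prop :=
  BasinCertificateAt K θ η fccKissingPattern ∧ BasinCertificateAt K θ η hcpKissingPattern

/-- **THE g30 CUT at one pattern: `R ∧ L ⟹ M`** (pure chaining: R supplies L's basin hypothesis). [folklore] -/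
theorem cappedRigidityAt_of_coarse_of_basin {K θ η : ℝ} {Pat : Finset E3} (hR : CoarseCappedRigidityAt K θ Pat)
    (hL : BasinCertificateAt K θ η Pat) : CappedRigidityAt θ η Pat :=
  fun N y i τ hy hsep hLk hC => hL N y i τ hy hsep hLk hC (hR N y i τ hy hsep hLk hC)

/-- **THE g30 CUT: `CoarseCappedRigidity K θ ∧ BasinCertificate K θ η ⟹ CappedRigidity θ η`.** [folklore] -/
theorem cappedRigidity_of_coarse_of_basin {K θ η : ℝ} (hR : CoarseCappedRigidity K θ) (hL : BasinCertificate K θ η) :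
    CappedRigidity θ η :=
  ⟨cappedRigidityAt_of_coarse_of_basin hR.1 hL.1, cappedRigidityAt_of_coarse_of_basin hR.2 hL.2⟩

/-- **L is vacuous below the crossover**: if `K·θ < η` the basin hypothesis already is the fit. [folklore] -/
theorem basinCertificateAt_of_lt {K θ η : ℝ} {Pat : Finset E3} (h : K * θ < η) : BasinCertificateAt K θ η Pat :=
  fun _N _y _i _τ _hy _hsep _hLk _hC hA₀ => by
    obtain ⟨A₀, hA₀⟩ := hA₀
    exact ⟨K * θ, A₀, h, hA₀⟩

/-- `K·θ < η ⟹ BasinCertificate K θ η`. [folklore] -/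
theorem basinCertificate_of_lt {K θ η : ℝ} (h : K * θ < η) : BasinCertificate K θ η :=
  ⟨basinCertificateAt_of_lt h, basinCertificateAt_of_lt h⟩

/-- **BASE RANGE: below the crossover R alone gives M** — `CoarseCappedRigidity K θ → CappedRigidity θ η` whenever `K·θ < η`. [folklore] -/
theorem cappedRigidity_of_coarse {K θ η : ℝ} (h : K * θ < η) (hR : CoarseCappedRigidity K θ) : CappedRigidity θ η :=
  cappedRigidity_of_coarse_of_basin hR (basinCertificate_of_lt h)

/-- Conversely, at or above the crossover R is implied by M: `CappedRigidity θ η → CoarseCappedRigidity K θ` whenever `η ≤ K·θ`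
(so at the literal `θ = 1/100`, `η = 1/20` the piece R with `K ≥ 5` is WEAKER than M, strictly unless M holds). [folklore] -/
theorem coarseCappedRigidity_of_cappedRigidity {K θ η : ℝ} (h : η ≤ K * θ) (hM : CappedRigidity θ η) :
    CoarseCappedRigidity K θ := by
  refine ⟨fun N y i τ hy hsep hL hC => ?_, fun N y i τ hy hsep hL hC => ?_⟩
  · obtain ⟨η', A, hη', hfit⟩ := hM.1 N y i τ hy hsep hL hC
    exact ⟨A, fun u => (hfit u).trans (mul_le_mul_of_nonneg_right (hη'.le.trans h) (nearestDist_nonneg y i))⟩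
  · obtain ⟨η', A, hη', hfit⟩ := hM.2 N y i τ hy hsep hL hC
    exact ⟨A, fun u => (hfit u).trans (mul_le_mul_of_nonneg_right (hη'.le.trans h) (nearestDist_nonneg y i))⟩

/-- **The g29 target from the g30 pieces at the registered literals**: `G ∧ P ∧ R(K, 1/100) ∧ L(K, 1/100, 1/20) ⟹ KR2Shape`. [folklore] -/
theorem kr2Shape_of_cells {K : ℝ} (hG : LinkClassification (1 / 100)) (hP : CapForcing (1 / 100))
    (hR : CoarseCappedRigidity K (1 / 100)) (hL : BasinCertificate K (1 / 100) (1 / 20)) : KR2Shape :=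
  kr2Shape_of_cut hG hP (cappedRigidity_of_coarse_of_basin hR hL)

/-! ### The cell lemmas of R (pure metric geometry of one cell; the foreseen split `R ⟸ TetraCell ∧ OctaCell ∧ FrameAssembly ∧ extraction`,
whose glue is bond-graph bookkeeping and is NOT claimed in this file) -/

/-- **`TetraCell c`** — centre + link triangle: if `u, w, x ∈ Pat` are pairwise contacts and the relative positions `p u, p w, p x` have radii in
`[d, (1+θ)d]` and mutual distances in `[d/(1+θ), (1+θ)²d]` (`0 < θ ≤ 1/100`, `d > 0`), then ONE linear isometry carries `d·u, d·w, d·x` to within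
`c·θ·d` of them.  [ATTACKABLE·S: a near-regular tetrahedron with apex `0`; elementary.] -/
def TetraCellAt (c : ℝ) (Pat : Finset E3) : Prop :=
  ∀ (θ d : ℝ), 0 < θ → θ ≤ 1 / 100 → 0 < d → ∀ (u w x : ↥Pat),
    dist (u : E3) (w : E3) = 1 → dist (w : E3) (x : E3) = 1 → dist (u : E3) (x : E3) = 1 →
      ∀ p : ↥Pat → E3,
        (∀ z : ↥Pat, z = u ∨ z = w ∨ z = x → d ≤ ‖p z‖ ∧ ‖p z‖ ≤ (1 + θ) * d) →
        (∀ z z' : ↥Pat, z = u ∨ z = w ∨ z = x → z' = u ∨ z' = w ∨ z' = x → z ≠ z' →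
            d / (1 + θ) ≤ dist (p z) (p z') ∧ dist (p z) (p z') ≤ (1 + θ) ^ 2 * d) →
          ∃ A : E3 →ₗᵢ[ℝ] E3, ∀ z : ↥Pat, z = u ∨ z = w ∨ z = x → ‖p z - d • A (z : E3)‖ ≤ c * θ * d

/-- **`OctaCell c`** — centre + link square + its cap = the OCTAHEDRAL cell: for a square of the link (diagonal `u, v` at pattern distance `√2`,
the other two vertices `w, w'` — the common contacts of `u` and `v`, themselves at pattern distance `√2`) with relative positions `p` and cap position `q` (relative to the centre)
satisfying the windows — radii in `[d, (1+θ)d]`, the four sides and the four cap bonds in `[d/(1+θ), (1+θ)²d]`, the two diagonals `≥ d`, the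
centre–cap distance `≥ d/(1+θ)` — ONE linear isometry carries the pattern square `d·{u, w, v, w'}` and the pattern cap `d·(u+v)` to within
`c·θ·d` of `p` and `q`.  [ATTACKABLE·S/M: the `K₂,₂,₂` bar framework with twelve near-equal bars is near the REGULAR octahedron or near-degenerate
(four vertices on the circle of intersection of two near-unit spheres, equal chords ⟹ consecutive arcs `2α` or `2π − 2α`, and `Σ = 2π` forces the
square), the degenerate branch being excluded by the antipodal lower bounds; this is the lemma that the cap buys — without `q` the square folds
along a diagonal (jitterbug, `not_krShape12`).] -/
def OctaCellAt (c : ℝ) (Pat : Finset E3) : Prop :=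
  ∀ (θ d : ℝ), 0 < θ → θ ≤ 1 / 100 → 0 < d → ∀ (u v w w' : ↥Pat), dist (u : E3) (v : E3) = Real.sqrt 2 →
    dist (w : E3) (u : E3) = 1 → dist (w : E3) (v : E3) = 1 → dist (w' : E3) (u : E3) = 1 → dist (w' : E3) (v : E3) = 1 →
      dist (w : E3) (w' : E3) = Real.sqrt 2 → ∀ (p : ↥Pat → E3) (q : E3),
        (∀ z : ↥Pat, z = u ∨ z = v ∨ z = w ∨ z = w' → d ≤ ‖p z‖ ∧ ‖p z‖ ≤ (1 + θ) * d) →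
        (∀ z z' : ↥Pat, z = u ∨ z = v → z' = w ∨ z' = w' →
            d / (1 + θ) ≤ dist (p z) (p z') ∧ dist (p z) (p z') ≤ (1 + θ) ^ 2 * d) →
        (∀ z : ↥Pat, z = u ∨ z = v ∨ z = w ∨ z = w' → d / (1 + θ) ≤ dist q (p z) ∧ dist q (p z) ≤ (1 + θ) ^ 2 * d) →
        d ≤ dist (p u) (p v) → d ≤ dist (p w) (p w') → d / (1 + θ) ≤ ‖q‖ →
          ∃ A : E3 →ₗᵢ[ℝ] E3, (∀ z : ↥Pat, z = u ∨ z = v ∨ z = w ∨ z = w' → ‖p z - d • A (z : E3)‖ ≤ c * θ * d) ∧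
            ‖q - d • A ((u : E3) + (v : E3))‖ ≤ c * θ * d

/-- **`FrameAssembly K c`** — gluing the fourteen cells: if EVERY link triangle of `Pat` and EVERY link square of `Pat` is `c·θ·d`-fitted by its
own linear isometry (the conclusions of `TetraCellAt c` / `OctaCellAt c` without the cap clause), and all NON-contact pairs are `≥ d` apart (without this the statement is FALSE: fold the three vertices on one side of an
equatorial edge-hexagon of the cuboctahedron across its plane — every cell stays congruent, two non-contacts come to `0.577·d`), then ONE linear
isometry fits all twelve within `K·θ·d`.  [ATTACKABLE·M: sequential placement — fit `A` to one square; each of the four triangles on its sides has two fitted vertices and apex `0`,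
which places its third vertex (lever `λ_T`); each of the four side squares then has three placed vertices, and `s₄ = s₁ − s₂ + s₃` up to the
square's own defect places the last four; a mirror placement across the plane of two placed vertices and `0` is excluded because the
reflected vertex lands `0.577·d` from (fcc, and four hcp steps) or ON (two hcp steps) a placed NON-contact, against the `≥ d` clause.  MEASURED
(lens-5 g30 `cells.py`, linear error forms `ε_v = a_v·ε_T + b_v·ε_O`): fcc worst vertex `7.1·ε_T + 10.1·ε_O`, hcp `13.9·ε_T + 14.4·ε_O` ⇒ with
`c_T = 2.09`, `c_O = 3.64`: `K ≈ 52` (fcc) / `82` (hcp) by this placement order (not optimised; any simultaneous least-squares gluing is already a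
small certificate).  Also INSTRUMENTABLE (finite-dimensional).  OctaCell sanity (`octa_search.py`): random far starts projected onto the window set
find NO far branch for `θ ≤ 1/20` (max deviation `3.1·θ` square / `4.9·θ` cap), far branches appear by `θ = 0.15`.] -/
def FrameAssemblyAt (K c : ℝ) (Pat : Finset E3) : Prop :=
  ∀ (θ d : ℝ), 0 < θ → θ ≤ 1 / 100 → 0 < d → ∀ p : ↥Pat → E3,
    (∀ u w x : ↥Pat, dist (u : E3) (w : E3) = 1 → dist (w : E3) (x : E3) = 1 → dist (u : E3) (x : E3) = 1 →
        ∃ A : E3 →ₗᵢ[ℝ] E3, ∀ z : ↥Pat, z = u ∨ z = w ∨ z = x → ‖p z - d • A (z : E3)‖ ≤ c * θ * d) →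
    (∀ u v w w' : ↥Pat, dist (u : E3) (v : E3) = Real.sqrt 2 → dist (w : E3) (u : E3) = 1 → dist (w : E3) (v : E3) = 1 →
        dist (w' : E3) (u : E3) = 1 → dist (w' : E3) (v : E3) = 1 → dist (w : E3) (w' : E3) = Real.sqrt 2 →
        ∃ A : E3 →ₗᵢ[ℝ] E3, ∀ z : ↥Pat, z = u ∨ z = v ∨ z = w ∨ z = w' → ‖p z - d • A (z : E3)‖ ≤ c * θ * d) →
    (∀ u v : ↥Pat, u ≠ v → dist (u : E3) (v : E3) ≠ 1 → d ≤ dist (p u) (p v)) →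
      ∃ A : E3 →ₗᵢ[ℝ] E3, ∀ z : ↥Pat, ‖p z - d • A (z : E3)‖ ≤ K * θ * d

/-- The three cell pieces at both patterns. -/
def CellLemmas (K c : ℝ) : Prop :=
  (TetraCellAt c fccKissingPattern ∧ TetraCellAt c hcpKissingPattern) ∧
    (OctaCellAt c fccKissingPattern ∧ OctaCellAt c hcpKissingPattern) ∧
      (FrameAssemblyAt K c fccKissingPattern ∧ FrameAssemblyAt K c hcpKissingPattern)

/-- `√2 ≠ 1`. [folklore] -/
theorem sqrt_two_ne_one : Real.sqrt 2 ≠ 1 := fun h => by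
  have h2 : Real.sqrt 2 ^ 2 = 2 := Real.sq_sqrt (by norm_num)
  rw [h] at h2
  norm_num at h2

/-- A pattern pair at distance `√2` is a pair of distinct non-contacts. [folklore] -/
theorem ne_and_dist_ne_one_of_dist_eq_sqrt_two {Pat : Finset E3} {u v : ↥Pat} (h : dist (u : E3) (v : E3) = Real.sqrt 2) :
    u ≠ v ∧ dist (u : E3) (v : E3) ≠ 1 := by
  refine ⟨?_, fun h1 => sqrt_two_ne_one (h ▸ h1)⟩
  rintro rfl
  rw [dist_self] at h
  exact (ne_of_lt (Real.sqrt_pos.2 (by norm_num : (0 : ℝ) < 2))) h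

/-- **`ExtractionAt θ`** — the bond-graph bookkeeping that feeds the cells [ATTACKABLE·S, TRUE: every clause is two lines of `bondGraph_adj` /
`nearestDist_le_dist` arithmetic plus two finite pattern facts — the contact graphs of both kissing patterns are twin-free (so `τ` is injective and a
pattern non-contact is a genuine non-bond `> nn_i`) and a `√2`-pair has exactly two common contacts (so a cap is not bonded to the centre, whence
`dist > nn_i/(1+θ)`)]: with `d = nn_i > 0` and `p u = y (τ u) − y i` — radii in `[d, (1+θ)d]`; contact pairs in `[d/(1+θ), (1+θ)²d]`;
distinct NON-contact pairs `≥ d`; every `√2`-pair `u, v` has a cap position `q` (relative to `y i`) with the four cap bonds in `[d/(1+θ), (1+θ)²d]` and `‖q‖ ≥ d/(1+θ)`. -/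
def ExtractionAt (θ : ℝ) (Pat : Finset E3) : Prop :=
  ∀ (N : ℕ) (y : Fin N → E3) (i : Fin N) (τ : ↥Pat → Fin N), Function.Injective y →
    (∀ a b : Fin N, a ≠ b → (7 : ℝ) / 10 ≤ dist (y a) (y b)) → LinkIso θ Pat y i τ → Capped θ Pat y i τ →
      0 < nearestDist y i ∧
      (∀ u : ↥Pat, nearestDist y i ≤ ‖y (τ u) - y i‖ ∧ ‖y (τ u) - y i‖ ≤ (1 + θ) * nearestDist y i) ∧
      (∀ u w : ↥Pat, dist (u : E3) (w : E3) = 1 →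
          nearestDist y i / (1 + θ) ≤ dist (y (τ u) - y i) (y (τ w) - y i) ∧
            dist (y (τ u) - y i) (y (τ w) - y i) ≤ (1 + θ) ^ 2 * nearestDist y i) ∧
      (∀ u v : ↥Pat, u ≠ v → dist (u : E3) (v : E3) ≠ 1 → nearestDist y i ≤ dist (y (τ u) - y i) (y (τ v) - y i)) ∧
      (∀ u v : ↥Pat, dist (u : E3) (v : E3) = Real.sqrt 2 → ∃ q : E3,
          (∀ z : ↥Pat, (z = u ∨ z = v ∨ (dist (z : E3) (u : E3) = 1 ∧ dist (z : E3) (v : E3) = 1)) →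
              nearestDist y i / (1 + θ) ≤ dist q (y (τ z) - y i) ∧ dist q (y (τ z) - y i) ≤ (1 + θ) ^ 2 * nearestDist y i) ∧
            nearestDist y i / (1 + θ) ≤ ‖q‖)

/-- Extraction at both patterns. -/
def Extraction (θ : ℝ) : Prop :=
  ExtractionAt θ fccKissingPattern ∧ ExtractionAt θ hcpKissingPattern

/-- **THE SPLIT OF R, GLUE PROVED: `Extraction θ ∧ TetraCell c ∧ OctaCell c ∧ FrameAssembly K c ⟹ CoarseCappedRigidity K θ`** at one pattern
(`0 < θ ≤ 1/100`; pure plumbing — extraction feeds the two cell lemmas, whose fits feed the frame assembly with `d = nn_i`). [folklore] -/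
theorem coarseCappedRigidityAt_of_cells {K c θ : ℝ} {Pat : Finset E3} (hθ0 : 0 < θ) (hθ1 : θ ≤ 1 / 100)
    (hE : ExtractionAt θ Pat) (hT : TetraCellAt c Pat) (hO : OctaCellAt c Pat) (hF : FrameAssemblyAt K c Pat) :
    CoarseCappedRigidityAt K θ Pat := by
  intro N y i τ hy hsep hL hC
  obtain ⟨hd, hrad, hbond, hdiag, hcap⟩ := hE N y i τ hy hsep hL hC
  refine hF θ (nearestDist y i) hθ0 hθ1 hd (fun z => y (τ z) - y i) ?_ ?_ (fun u v hne h1 => hdiag u v hne h1)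
  · intro u w x huw hwx hux
    have key : ∀ z z' : ↥Pat, (z = u ∨ z = w ∨ z = x) → (z' = u ∨ z' = w ∨ z' = x) → z ≠ z' → dist (z : E3) (z' : E3) = 1 := by
      rintro z z' (rfl | rfl | rfl) (rfl | rfl | rfl) hne <;>
        first | exact absurd rfl hne | assumption | (rw [dist_comm]; assumption)
    exact hT θ (nearestDist y i) hθ0 hθ1 hd u w x huw hwx hux (fun z => y (τ z) - y i) (fun z _ => hrad z)
      (fun z z' hz hz' hne => hbond z z' (key z z' hz hz' hne))
  · intro u v w w' huv hwu hwv hw'u hw'v hww'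
    obtain ⟨q, hq, hq0⟩ := hcap u v huv
    have key : ∀ z z' : ↥Pat, (z = u ∨ z = v) → (z' = w ∨ z' = w') → dist (z : E3) (z' : E3) = 1 := by
      rintro z z' (rfl | rfl) (rfl | rfl) <;> rw [dist_comm] <;> assumption
    have key' : ∀ z : ↥Pat, (z = u ∨ z = v ∨ z = w ∨ z = w') →
        (z = u ∨ z = v ∨ (dist (z : E3) (u : E3) = 1 ∧ dist (z : E3) (v : E3) = 1)) := by
      rintro z (rfl | rfl | rfl | rfl)
      · exact Or.inl rfl
      · exact Or.inr (Or.inl rfl)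
      · exact Or.inr (Or.inr ⟨hwu, hwv⟩)
      · exact Or.inr (Or.inr ⟨hw'u, hw'v⟩)
    obtain ⟨A, hA, -⟩ := hO θ (nearestDist y i) hθ0 hθ1 hd u v w w' huv hwu hwv hw'u hw'v hww' (fun z => y (τ z) - y i) q
      (fun z _ => hrad z) (fun z z' hz hz' => hbond z z' (key z z' hz hz')) (fun z hz => hq z (key' z hz))
      (hdiag u v (ne_and_dist_ne_one_of_dist_eq_sqrt_two huv).1 (ne_and_dist_ne_one_of_dist_eq_sqrt_two huv).2)
      (hdiag w w' (ne_and_dist_ne_one_of_dist_eq_sqrt_two hww').1 (ne_and_dist_ne_one_of_dist_eq_sqrt_two hww').2) hq0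
    exact ⟨A, hA⟩

/-- **`Extraction θ ∧ CellLemmas K c ⟹ CoarseCappedRigidity K θ`** (`0 < θ ≤ 1/100`). [folklore] -/
theorem coarseCappedRigidity_of_cells {K c θ : ℝ} (hθ0 : 0 < θ) (hθ1 : θ ≤ 1 / 100) (hE : Extraction θ) (hcells : CellLemmas K c) :
    CoarseCappedRigidity K θ :=
  ⟨coarseCappedRigidityAt_of_cells hθ0 hθ1 hE.1 hcells.1.1 hcells.2.1.1 hcells.2.2.1,
    coarseCappedRigidityAt_of_cells hθ0 hθ1 hE.2 hcells.1.2 hcells.2.1.2 hcells.2.2.2⟩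

/-- **The uniform coarse piece from the cells**: `(∀ θ, Extraction θ) ∧ CellLemmas K c ⟹ UniformCoarseCappedRigidity K`. [folklore] -/
theorem uniformCoarseCappedRigidity_of_cells {K c : ℝ} (hE : ∀ θ : ℝ, 0 < θ → θ ≤ 1 / 100 → Extraction θ)
    (hcells : CellLemmas K c) : UniformCoarseCappedRigidity K :=
  fun θ hθ0 hθ1 => coarseCappedRigidity_of_cells hθ0 hθ1 (hE θ hθ0 hθ1) hcells

/-- **M from the cells and the certificate** at any literal: `Extraction θ ∧ CellLemmas K c ∧ BasinCertificate K θ η ⟹ CappedRigidity θ η`;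
below the crossover (`K·θ < η`) the certificate is `basinCertificate_of_lt`. [folklore] -/
theorem cappedRigidity_of_cells {K c θ η : ℝ} (hθ0 : 0 < θ) (hθ1 : θ ≤ 1 / 100) (hE : Extraction θ) (hcells : CellLemmas K c)
    (hL : BasinCertificate K θ η) : CappedRigidity θ η :=
  cappedRigidity_of_coarse_of_basin (coarseCappedRigidity_of_cells hθ0 hθ1 hE hcells) hL

/-! ### The θ-parametric cut through the tolerance door (p818040) and the θ-DIAL -/

/-- **`KR2Tol θ η`** — hypothesis `h2` of `FrustratedLawDichotomyTwoShellRigidityDoorTol.frustrationDensityGap_of_price_of_kr2`, VERBATIM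
(the two-shell kissing-rigidity statement at bond tolerance `θ` and fit tolerance `η`; `KR2Shape` is its `θ = 1/100` instance with `∃ η < 1/20`). -/
def KR2Tol (θ η : ℝ) : Prop :=
  ∀ (N : ℕ) (y : Fin N → EuclideanSpace ℝ (Fin 3)), Function.Injective y → (∀ a b : Fin N, a ≠ b → (7 : ℝ) / 10 ≤ dist (y a) (y b)) → ∀ i : Fin N, Literature.Geometry.DiscreteGeometry.IsChargeFree θ y i → (∀ j : Fin N, (Literature.Geometry.DiscreteGeometry.bondGraph θ y).Adj i j → Literature.Geometry.DiscreteGeometry.IsChargeFree θ y j) → ∃ A : EuclideanSpace ℝ (Fin 3) →ₗᵢ[ℝ] EuclideanSpace ℝ (Fin 3), ((∃ τ : ↥Literature.Geometry.DiscreteGeometry.fccKissingPattern → Fin N, (∀ u : ↥Literature.Geometry.DiscreteGeometry.fccKissingPattern, (Literature.Geometry.DiscreteGeometry.bondGraph θ y).Adj i (τ u)) ∧ (∀ k : Fin N, (Literature.Geometry.DiscreteGeometry.bondGraph θ y).Adj i k → ∃ u : ↥Literature.Geometry.DiscreteGeometry.fccKissingPattern, τ u = k) ∧ (∀ u : ↥Literature.Geometry.DiscreteGeometry.fccKissingPattern,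 ‖(y (τ u) - y i) - Literature.Geometry.DiscreteGeometry.nearestDist y i • A (u : EuclideanSpace ℝ (Fin 3))‖ ≤ η * Literature.Geometry.DiscreteGeometry.nearestDist y i)) ∨ (∃ τ : ↥Literature.Geometry.DiscreteGeometry.hcpKissingPattern → Fin N, (∀ u : ↥Literature.Geometry.DiscreteGeometry.hcpKissingPattern, (Literature.Geometry.DiscreteGeometry.bondGraph θ y).Adj i (τ u)) ∧ (∀ k : Fin N, (Literature.Geometry.DiscreteGeometry.bondGraph θ y).Adj i k → ∃ u : ↥Literature.Geometry.DiscreteGeometry.hcpKissingPattern, τ u = k) ∧ (∀ u : ↥Literature.Geometry.DiscreteGeometry.hcpKissingPattern, ‖(y (τ u) - y i) - Literature.Geometry.DiscreteGeometry.nearestDist y i • A (u : EuclideanSpace ℝ (Fin 3))‖ ≤ η * Literature.Geometry.DiscreteGeometry.nearestDist y i)))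

/-- **`PriceTol θ`** — hypothesis `hprice` of the same door, VERBATIM: `∃ κ > 0, κ·#charged_θ(y) ≤ U(y) − N·e⋆` for all finite injective `y`
(`= ChargedEnergyGap`, item 14231, at `θ = 1/100` by `chargedEnergyGap_iff_price`). -/
def PriceTol (θ : ℝ) : Prop :=
  ∃ κ : ℝ, 0 < κ ∧ ∀ (N : ℕ) (y : Fin N → EuclideanSpace ℝ (Fin 3)), Function.Injective y → κ * (charged θ y : ℝ) ≤ interactionEnergy lennardJones y - (N : ℝ) * eStar

/-- **`G θ ∧ P θ ∧ M(θ, η) ⟹ KR2Tol θ η`** (pure chaining; `η'·nn_i ≤ η·nn_i` by `nearestDist_nonneg`). [folklore] -/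
theorem kr2Tol_of_cut {θ η : ℝ} (hG : LinkClassification θ) (hP : CapForcing θ) (hM : CappedRigidity θ η) : KR2Tol θ η := by
  intro N y hy hsep i hcf hcf2
  have hnb : ∀ j : Fin N, (bondGraph θ y).Adj i j →
      (∃ τ' : ↥fccKissingPattern → Fin N, LinkIso θ fccKissingPattern y j τ') ∨
        (∃ τ' : ↥hcpKissingPattern → Fin N, LinkIso θ hcpKissingPattern y j τ') :=
    fun j hj => hG N y hy hsep j (hcf2 j hj)
  have hnn := nearestDist_nonneg y i
  rcases hG N y hy hsep i hcf with ⟨τ, hL⟩ | ⟨τ, hL⟩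
  · obtain ⟨η', A, hη', hfit⟩ := hM.1 N y i τ hy hsep hL (hP.1 N y i τ hy hsep hcf hcf2 hL hnb)
    exact ⟨A, Or.inl ⟨τ, hL.1, hL.2.1, fun u => (hfit u).trans (mul_le_mul_of_nonneg_right hη'.le hnn)⟩⟩
  · obtain ⟨η', A, hη', hfit⟩ := hM.2 N y i τ hy hsep hL (hP.2 N y i τ hy hsep hcf hcf2 hL hnb)
    exact ⟨A, Or.inr ⟨τ, hL.1, hL.2.1, fun u => (hfit u).trans (mul_le_mul_of_nonneg_right hη'.le hnn)⟩⟩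

/-- **FDG from `Price θ ∧ G θ ∧ P θ ∧ M(θ, η)`** for any `0 < θ ≤ 1/100`, `η < 1/20` (through p818040). [folklore] -/
theorem frustrationDensityGap_of_price_of_cut {θ η : ℝ} (hθ0 : 0 < θ) (hθ1 : θ ≤ 1 / 100) (hη : η < 1 / 20)
    (hprice : PriceTol θ) (hG : LinkClassification θ) (hP : CapForcing θ) (hM : CappedRigidity θ η) :
    ∃ κ : ℝ, 0 < κ ∧ ∃ C : ℝ, ∀ (N : ℕ) (y : Fin N → EuclideanSpace ℝ (Fin 3)), Function.Injective y → (∀ a b : Fin N, a ≠ b → (7 : ℝ) / 10 ≤ dist (y a) (y b)) → κ * N - C * (Nat.card {i : Fin N // ∃ (d η γ : ℝ) (A : EuclideanSpace ℝ (Fin 3) →ₗᵢ[ℝ] EuclideanSpace ℝ (Fin 3)), (∃ t : ↥Literature.Geometry.DiscreteGeometry.fccKissingPattern → EuclideanSpace ℝ (Fin 3), 0 < d ∧ 0 < γ ∧ η < 1 / 20 ∧ (∀ u : ↥Literature.Geometry.DiscreteGeometry.fccKissingPattern, t u ∈ (Set.range y) ∧ ‖(t u - (y i)) - d • A (u : EuclideanSpace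 ℝ (Fin 3))‖ ≤ η * d) ∧ (∀ s : EuclideanSpace ℝ (Fin 3), s ∈ (Set.range y) → s ≠ (y i) → d ≤ dist s (y i)) ∧ (∃ s : EuclideanSpace ℝ (Fin 3), s ∈ (Set.range y) ∧ s ≠ (y i) ∧ dist s (y i) ≤ d) ∧ (∀ s : EuclideanSpace ℝ (Fin 3), s ∈ (Set.range y) → s ≠ (y i) → dist s (y i) < 13 / 10 * d + γ → dist s (y i) ≤ 13 / 10 * d - γ ∧ s ∈ Set.range t)) ∨ (∃ t : ↥Literature.Geometry.DiscreteGeometry.hcpKissingPattern → EuclideanSpace ℝ (Fin 3), 0 < d ∧ 0 < γ ∧ η < 1 / 20 ∧ (∀ u : ↥Literature.Geometry.DiscreteGeometry.hcpKissingPattern, t u ∈ (Set.range y) ∧ ‖(t u - (y i)) - d • A (u : EuclideanSpace ℝ (Fin 3))‖ ≤ η * d) ∧ (∀ s : EuclideanSpace ℝ (Fin 3), s ∈ (Set.range y) → s ≠ (y i) → d ≤ dist s (y i)) ∧ (∃ s : EuclideanSpace ℝ (Fin 3), s ∈ (Set.range y) ∧ s ≠ (y i) ∧ dist s (y i) ≤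 d) ∧ (∀ s : EuclideanSpace ℝ (Fin 3), s ∈ (Set.range y) → s ≠ (y i) → dist s (y i) < 13 / 10 * d + γ → dist s (y i) ≤ 13 / 10 * d - γ ∧ s ∈ Set.range t))} : ℝ) ≤ Literature.MathematicalPhysics.StatisticalMechanics.interactionEnergy Literature.MathematicalPhysics.StatisticalMechanics.lennardJones y - N * (⨅ Q : Literature.MathematicalPhysics.StatisticalMechanics.PeriodicConfiguration 3, Q.energyPerParticle Literature.MathematicalPhysics.StatisticalMechanics.lennardJones) :=
  frustrationDensityGap_of_price_of_kr2 hθ0 hθ1 hη hprice (kr2Tol_of_cut hG hP hM)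

/-- **`AperiodicFrustratedLawGap` (crux of item 27623) BY NAME from `MuEquilibriumDoor ∧ Price θ ∧ G θ ∧ P θ ∧ M(θ, η)`**, any
`0 < θ ≤ 1/100`, `η < 1/20`. [folklore] -/
theorem aperiodicFrustratedLawGap_of_price_of_cut {θ η : ℝ} (hθ0 : 0 < θ) (hθ1 : θ ≤ 1 / 100) (hη : η < 1 / 20)
    (hDoor : Summit.AtomisticToContinuum.Crystallization.Theses.GrainCoreNetworkSplit.MuEquilibriumDoor) (hprice : PriceTol θ)
    (hG : LinkClassification θ) (hP : CapForcing θ) (hM : CappedRigidity θ η) :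
    Summit.AtomisticToContinuum.Crystallization.Theses.FrustratedLawDichotomy.AperiodicFrustratedLawGap :=
  aperiodicFrustratedLawGap_of_price_of_kr2 hθ0 hθ1 hη hDoor hprice (kr2Tol_of_cut hG hP hM)

/-- **`NoFrustratedPeriodicMinimiser` (item 26654), DOOR-FREE, from `Price θ ∧ G θ ∧ P θ ∧ M(θ, η)`.** [folklore] -/
theorem noFrustratedPeriodicMinimiser_of_price_of_cut {θ η : ℝ} (hθ0 : 0 < θ) (hθ1 : θ ≤ 1 / 100) (hη : η < 1 / 20)
    (hprice : PriceTol θ) (hG : LinkClassification θ) (hP : CapForcing θ) (hM : CappedRigidity θ η) :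
    Summit.AtomisticToContinuum.Crystallization.Theses.PeriodicChargeSplit.NoFrustratedPeriodicMinimiser :=
  noFrustratedPeriodicMinimiser_of_price_of_kr2 hθ0 hθ1 hη hprice (kr2Tol_of_cut hG hP hM)

/-- **THE θ-DIAL (base range of the tolerance): below the crossover `θ < 1/(20·K)` the column needs NO certificate** —
`MuEquilibriumDoor ∧ Price θ ∧ G θ ∧ P θ ∧ CoarseCappedRigidity K θ ⟹ AperiodicFrustratedLawGap` (take `η` half-way between `K·θ` and `1/20`).
[folklore] -/
theorem aperiodicFrustratedLawGap_of_price_of_coarse {K θ : ℝ} (hθ0 : 0 < θ) (hθ1 : θ ≤ 1 / 100) (hK : K * θ < 1 / 20)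
    (hDoor : Summit.AtomisticToContinuum.Crystallization.Theses.GrainCoreNetworkSplit.MuEquilibriumDoor) (hprice : PriceTol θ)
    (hG : LinkClassification θ) (hP : CapForcing θ) (hR : CoarseCappedRigidity K θ) :
    Summit.AtomisticToContinuum.Crystallization.Theses.FrustratedLawDichotomy.AperiodicFrustratedLawGap :=
  have hη : (K * θ + 1 / 20) / 2 < 1 / 20 := by linarith
  have hlt : K * θ < (K * θ + 1 / 20) / 2 := by linarith
  aperiodicFrustratedLawGap_of_price_of_cut hθ0 hθ1 hη hDoor hprice hG hP (cappedRigidity_of_coarse hlt hR)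

/-- **θ-DIAL, door-free sibling**: `Price θ ∧ G θ ∧ P θ ∧ CoarseCappedRigidity K θ ⟹ NoFrustratedPeriodicMinimiser` for `θ < 1/(20·K)`.
[folklore] -/
theorem noFrustratedPeriodicMinimiser_of_price_of_coarse {K θ : ℝ} (hθ0 : 0 < θ) (hθ1 : θ ≤ 1 / 100) (hK : K * θ < 1 / 20)
    (hprice : PriceTol θ) (hG : LinkClassification θ) (hP : CapForcing θ) (hR : CoarseCappedRigidity K θ) :
    Summit.AtomisticToContinuum.Crystallization.Theses.PeriodicChargeSplit.NoFrustratedPeriodicMinimiser :=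
  have hη : (K * θ + 1 / 20) / 2 < 1 / 20 := by linarith
  have hlt : K * θ < (K * θ + 1 / 20) / 2 := by linarith
  noFrustratedPeriodicMinimiser_of_price_of_cut hθ0 hθ1 hη hprice hG hP (cappedRigidity_of_coarse hlt hR)

/-- **The dial with the UNIFORM coarse piece**: `UniformCoarseCappedRigidity K` serves every literal `0 < θ ≤ 1/100`; below `1/(20·K)` alone,
above it together with `BasinCertificate K θ η`. [folklore] -/
theorem cappedRigidity_of_uniform {K θ η : ℝ} (hθ0 : 0 < θ) (hθ1 : θ ≤ 1 / 100) (hR : UniformCoarseCappedRigidity K)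
    (hL : BasinCertificate K θ η) : CappedRigidity θ η :=
  cappedRigidity_of_coarse_of_basin (hR θ hθ0 hθ1) hL

/-! ### M⁺ — the ONE finite two-shell statement shared by FLD and by lens-4's B₁ (critic row 428 (5)) -/

/-- **M⁺ at one pattern = `CappedRigidityBothAt θ η₁ η₂`**: link isomorphism + caps ⟹ ONE linear isometry `A` fits the bonded dozen within
`η₁·nn_i` AND every site `m ≠ i` bonded to (τ of) all four vertices of a link square — every cap — within `η₂·nn_i` of the ideal cap
`nn_i·A(u+v)`.  [UNDECIDED·TRUE-type · STRONGER than M for `η₁ < η` (`cappedRigidity_of_both`) · INSTRUMENTABLE: census TAG 157 variant D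
(KR18-C with the squared windows, all 18 points reported); FLD takes `η₁ < 1/20`, lens-4 takes `max η₁ η₂` + scale absorption `≤ 3/50`.]
Why it might fail: only through the constants (census KR18: first shell `≈ 3.95·θ`; caps unmeasured, maximiser cap radii `1.400–1.439` at
`θ = 1/100`).  Sources: critic rows 426 (iii), 428 (5); census KR18 (STATUS l.1980). -/
def CappedRigidityBothAt (θ η₁ η₂ : ℝ) (Pat : Finset E3) : Prop :=
  ∀ (N : ℕ) (y : Fin N → E3) (i : Fin N) (τ : ↥Pat → Fin N), Function.Injective y →
    (∀ a b : Fin N, a ≠ b → (7 : ℝ) / 10 ≤ dist (y a) (y b)) → LinkIso θ Pat y i τ → Capped θ Pat y i τ →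
      ∃ A : E3 →ₗᵢ[ℝ] E3, (∀ u : ↥Pat, ‖(y (τ u) - y i) - nearestDist y i • A (u : E3)‖ ≤ η₁ * nearestDist y i) ∧
        ∀ (u v : ↥Pat) (m : Fin N), dist (u : E3) (v : E3) = Real.sqrt 2 → m ≠ i →
          (∀ w : ↥Pat, (w = u ∨ w = v ∨ (dist (w : E3) (u : E3) = 1 ∧ dist (w : E3) (v : E3) = 1)) →
              (bondGraph θ y).Adj m (τ w)) →
            ‖(y m - y i) - nearestDist y i • A ((u : E3) + (v : E3))‖ ≤ η₂ * nearestDist y i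

/-- **M⁺ = `CappedRigidityBoth θ η₁ η₂`** at both patterns. -/
def CappedRigidityBoth (θ η₁ η₂ : ℝ) : Prop :=
  CappedRigidityBothAt θ η₁ η₂ fccKissingPattern ∧ CappedRigidityBothAt θ η₁ η₂ hcpKissingPattern

/-- FLD's reading of M⁺: `η₁ < η → CappedRigidityBoth θ η₁ η₂ → CappedRigidity θ η` (forget the caps). [folklore] -/
theorem cappedRigidity_of_both {θ η η₁ η₂ : ℝ} (hlt : η₁ < η) (h : CappedRigidityBoth θ η₁ η₂) : CappedRigidity θ η := by
  refine ⟨fun N y i τ hy hsep hL hC => ?_, fun N y i τ hy hsep hL hC => ?_⟩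
  · obtain ⟨A, h1, -⟩ := h.1 N y i τ hy hsep hL hC
    exact ⟨η₁, A, hlt, h1⟩
  · obtain ⟨A, h1, -⟩ := h.2 N y i τ hy hsep hL hC
    exact ⟨η₁, A, hlt, h1⟩

/-- M⁺ through the cut at the literals: `G(1/100) → P(1/100) → CappedRigidityBoth (1/100) η₁ η₂ → η₁ < 1/20 → KR2Shape`. [folklore] -/
theorem kr2Shape_of_both {η₁ η₂ : ℝ} (hG : LinkClassification (1 / 100)) (hP : CapForcing (1 / 100))
    (hM : CappedRigidityBoth (1 / 100) η₁ η₂) (hlt : η₁ < 1 / 20) : KR2Shape :=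
  kr2Shape_of_cut hG hP (cappedRigidity_of_both hlt hM)

end Summit.AtomisticToContinuum.Crystallization.Theorems.FrustratedLawDichotomyTwoShellRigidityCells
end
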